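import Literature.NumberTheory.CubicFields.ThreeTorsionParametrizationTheta
import HarnessLib

/-!
# Uniqueness in Bhargava's parametrization: a geometric progression `θ₀, θ₁, θ₂, θ₃` with integral `π`-parts is `θ(C)` or its conjugate-opposite (HCL I, proof of Thm 13)

Topic `Literature/NumberTheory/CubicFields`, continuing `ThreeTorsionParametrizationTheta.lean`.
Sixth step of the class-field-theory-free road to the Davenport–Heilbronn theorem on `Cl(K)[3]`
(Bhargava–Varma 2016, §§2–3): the uniqueness half of HCL I Thm 13.

Bhargava, HCL I, proof of Thm 13: "The associativity and commutativity of `S` implies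
`(α²β)² = α³ · αβ²` and `(αβ²)² = α²β · β³`. Expanding these identities using (21), we obtain two
linear and two quadratic equations in `c₀, c₁, c₂, c₃`. Assuming the basis `α, β` of `I` has
positive orientation, we find that this system of four equations for the `cᵢ` has exactly one
solution, given by [the displayed `c₀, …, c₃`]". In the language of the previous files: the four
values `θᵢ = (α³, α²β, αβ², β³)ᵢ/δ ∈ K` form a *geometric progression*
(`θ₀θ₂ = θ₁²`, `θ₁θ₃ = θ₂²`, `θ₀θ₃ = θ₁θ₂`) whose `π`-parts (`τ`-coordinates)
`(θᵢ − σθᵢ)/s = aᵢ` are the coefficients of `C`, `σ` the conjugation of `K = ℚ(s)`, `s² = D`.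
This file proves that such a progression is determined by `(a₀, a₁, a₂, a₃)` up to the
orientation ambiguity:

* `hess_quadratic_eq_zero` — **`A θ₁² + B θ₀θ₁ + C θ₀² = 0`** (`(A, B, C)` the Hessian of `C`): the
  ratio `λ = θ₁/θ₀ = β/α` is a root of the Hessian quadratic `AX² + BX + C` (classically: the
  Hessian of a binary cubic vanishes at the "polar" linear factors);
* `two_A_mul_theta₁_eq` — hence `2Aθ₁ = (−B ± s)θ₀` when `disc C = D = s²`;
* `eq_thetaForm_or_eq_neg_conj` — **uniqueness**: if moreover the progression is nondegenerate
  (`θ₀ · σθ₁ ≠ σθ₀ · θ₁`, i.e. `λ ∉ ℚ`: `α, β` independent) and `D` is not a square, then either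
  `θᵢ = θᵢ(C) = (gᵢ + aᵢs)/2` for all `i` (the positively oriented case), or `θᵢ = −σ(θᵢ(C)) =
  (−gᵢ + aᵢs)/2` for all `i` — "exactly one solution" once the orientation is fixed.

The conjugation enters only as a ring endomorphism `σ` of `K` with `σ s = −s` (for the quadratic
field `K = ℚ(√D)` it is the nontrivial automorphism, `QuadraticFields/SquareRootGenerator.lean`).
All statements are proved.

## References

* M. Bhargava, *Higher composition laws I*, Ann. of Math. 159 (2004), §3.4, proof of Thm 13 (the
  uniqueness of `c₀, …, c₃`, eqs. (21)–(23)) [Bhargava2004HCL1].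
* M. Bhargava, I. Varma, Proc. LMS 112 (2016) = arXiv:1401.5875, §2.1 ("This uniquely determines
  `α` and `β` up to a scalar factor") [BhargavaVarma2016].
-/

namespace Literature.NumberTheory.CubicFields

namespace SymCubic

variable {K : Type*} [Field K] [CharZero K]

omit [CharZero K] in
/-- Two geometric progressions with the same nonzero first term and the same second term agree.
[folklore] -/
theorem progression_eq_of_eq {φ₀ φ₁ φ₂ φ₃ ψ₀ ψ₁ ψ₂ ψ₃ : K} (hφ02 : φ₀ * φ₂ = φ₁ ^ 2)
    (hφ03 : φ₀ * φ₃ = φ₁ * φ₂) (hψ02 : ψ₀ * ψ₂ = ψ₁ ^ 2) (hψ03 : ψ₀ * ψ₃ = ψ₁ * ψ₂)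
    (h0 : φ₀ = ψ₀) (h1 : φ₁ = ψ₁) (hne : ψ₀ ≠ 0) : φ₂ = ψ₂ ∧ φ₃ = ψ₃ := by
  subst h0 h1
  have h2 : φ₂ = ψ₂ := mul_left_cancel₀ hne (by rw [hφ02, hψ02])
  subst h2
  exact ⟨rfl, mul_left_cancel₀ hne (by rw [hφ03, hψ03])⟩

/-- `s ≠ 0` when `s² = disc a` is not a square. [folklore] -/
theorem s_ne_zero_of_not_isSquare (a : SymCubic ℤ) {s : K} (hs : s ^ 2 = (a.disc : K))
    (hD : ¬ IsSquare a.disc) : s ≠ 0 := by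
  rintro rfl
  apply hD
  refine ⟨0, ?_⟩
  have : ((a.disc : ℤ) : K) = 0 := by rw [← hs]; ring
  exact_mod_cast this

/-- `A ≠ 0` when `disc a` is not a square (else `disc a = B²`). [folklore] -/
theorem hess_A_ne_zero_of_not_isSquare (a : SymCubic ℤ) (hD : ¬ IsSquare a.disc) : a.hess.1 ≠ 0 := by
  intro hA
  apply hD
  refine ⟨a.hess.2.1, ?_⟩
  have := discr_hess a
  rw [hA] at this
  linarith [this]

section Progression

variable (a : SymCubic ℤ) (σ : K →+* K) {s : K} (hσ : σ s = -s)
  {θ₀ θ₁ θ₂ θ₃ : K} (h02 : θ₀ * θ₂ = θ₁ ^ 2) (h13 : θ₁ * θ₃ = θ₂ ^ 2) (h03 : θ₀ * θ₃ = θ₁ * θ₂)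
  (hπ₀ : θ₀ - σ θ₀ = (a.a₀ : K) * s) (hπ₁ : θ₁ - σ θ₁ = (a.a₁ : K) * s)
  (hπ₂ : θ₂ - σ θ₂ = (a.a₂ : K) * s) (hπ₃ : θ₃ - σ θ₃ = (a.a₃ : K) * s)
include h02 h13 h03 hπ₀ hπ₁ hπ₂ hπ₃

omit [CharZero K] h02 h13 h03 hπ₃ in
/-- `A s² = (θ₁ − σθ₁)² − (θ₀ − σθ₀)(θ₂ − σθ₂)` (definition of `A = a₁² − a₀a₂` through the
`π`-parts). [folklore] -/
theorem hess_A_mul_sq : (a.hess.1 : K) * s ^ 2 = (θ₁ - σ θ₁) ^ 2 - (θ₀ - σ θ₀) * (θ₂ - σ θ₂) := by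
  rw [hπ₀, hπ₁, hπ₂]
  simp only [hess]
  push_cast
  ring

omit [CharZero K] h02 h13 h03 in
/-- `B s² = (θ₀ − σθ₀)(θ₃ − σθ₃) − (θ₁ − σθ₁)(θ₂ − σθ₂)`. [folklore] -/
theorem hess_B_mul_sq : (a.hess.2.1 : K) * s ^ 2 = (θ₀ - σ θ₀) * (θ₃ - σ θ₃) - (θ₁ - σ θ₁) * (θ₂ - σ θ₂) := by
  rw [hπ₀, hπ₁, hπ₂, hπ₃]
  simp only [hess]
  push_cast
  ring

omit [CharZero K] h02 h13 h03 hπ₀ in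
/-- `C s² = (θ₂ − σθ₂)² − (θ₁ − σθ₁)(θ₃ − σθ₃)`. [folklore] -/
theorem hess_C_mul_sq : (a.hess.2.2 : K) * s ^ 2 = (θ₂ - σ θ₂) ^ 2 - (θ₁ - σ θ₁) * (θ₃ - σ θ₃) := by
  rw [hπ₁, hπ₂, hπ₃]
  simp only [hess]
  push_cast
  ring

omit [CharZero K] in
/-- **The ratio `θ₁ : θ₀` is a root of the Hessian**: `s² · (A θ₁² + B θ₀θ₁ + C θ₀²) = 0`, from the
progression relations for `θ` and for `σθ`. [folklore] -/
theorem sq_mul_hess_quadratic_eq_zero :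
    s ^ 2 * ((a.hess.1 : K) * θ₁ ^ 2 + (a.hess.2.1 : K) * (θ₀ * θ₁) + (a.hess.2.2 : K) * θ₀ ^ 2) = 0 := by
  have hA := hess_A_mul_sq a σ hπ₀ hπ₁ hπ₂
  have hB := hess_B_mul_sq a σ hπ₀ hπ₁ hπ₂ hπ₃
  have hC := hess_C_mul_sq a σ hπ₁ hπ₂ hπ₃
  have s02 : σ θ₀ * σ θ₂ = σ θ₁ ^ 2 := by rw [← map_mul, ← map_pow, h02]
  have s13 : σ θ₁ * σ θ₃ = σ θ₂ ^ 2 := by rw [← map_mul, ← map_pow, h13]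
  have s03 : σ θ₀ * σ θ₃ = σ θ₁ * σ θ₂ := by rw [← map_mul, ← map_mul, h03]
  linear_combination θ₁ ^ 2 * hA + (θ₀ * θ₁) * hB + θ₀ ^ 2 * hC
    + (2 * θ₁ * σ θ₁ - 2 * θ₀ * σ θ₂ - θ₁ ^ 2) * h02 + (θ₀ * σ θ₁ - θ₁ * σ θ₀ + θ₀ * θ₁) * h03
    - θ₀ ^ 2 * h13 - θ₁ ^ 2 * s02 + (θ₀ * θ₁) * s03 - θ₀ ^ 2 * s13

end Progression

section Uniqueness

variable (a : SymCubic ℤ) (σ : K →+* K) {s : K} (hσ : σ s = -s) (hs : s ^ 2 = (a.disc : K))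
  (hD : ¬ IsSquare a.disc)
  {θ₀ θ₁ θ₂ θ₃ : K} (h02 : θ₀ * θ₂ = θ₁ ^ 2) (h13 : θ₁ * θ₃ = θ₂ ^ 2) (h03 : θ₀ * θ₃ = θ₁ * θ₂)
  (hπ₀ : θ₀ - σ θ₀ = (a.a₀ : K) * s) (hπ₁ : θ₁ - σ θ₁ = (a.a₁ : K) * s)
  (hπ₂ : θ₂ - σ θ₂ = (a.a₂ : K) * s) (hπ₃ : θ₃ - σ θ₃ = (a.a₃ : K) * s)
include hσ hs hD h02 h13 h03 hπ₀ hπ₁ hπ₂ hπ₃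

omit hσ in
/-- **`(2Aθ₁ + Bθ₀)² = s²θ₀²`**, i.e. `2Aθ₁ = (−B ± s) θ₀`. [folklore] -/
theorem two_A_mul_theta₁_eq :
    2 * (a.hess.1 : K) * θ₁ = (-(a.hess.2.1 : K) + s) * θ₀ ∨
      2 * (a.hess.1 : K) * θ₁ = (-(a.hess.2.1 : K) - s) * θ₀ := by
  have hq := sq_mul_hess_quadratic_eq_zero a σ h02 h13 h03 hπ₀ hπ₁ hπ₂ hπ₃
  have hs0 := s_ne_zero_of_not_isSquare a hs hD
  have hq' : (a.hess.1 : K) * θ₁ ^ 2 + (a.hess.2.1 : K) * (θ₀ * θ₁) + (a.hess.2.2 : K) * θ₀ ^ 2 = 0 := by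
    rcases mul_eq_zero.mp hq with h | h
    · exact absurd h (pow_ne_zero 2 hs0)
    · exact h
  have hdisc : (a.hess.2.1 : K) ^ 2 - 4 * (a.hess.1 : K) * (a.hess.2.2 : K) = s ^ 2 := by
    rw [hs, ← discr_hess a]; push_cast; ring
  have key : (2 * (a.hess.1 : K) * θ₁ - (-(a.hess.2.1 : K) + s) * θ₀)
      * (2 * (a.hess.1 : K) * θ₁ - (-(a.hess.2.1 : K) - s) * θ₀) = 0 := by
    linear_combination (4 * (a.hess.1 : K)) * hq' + θ₀ ^ 2 * hdisc
  rcases mul_eq_zero.mp key with h | h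
  · exact Or.inl (sub_eq_zero.mp h)
  · exact Or.inr (sub_eq_zero.mp h)

/-- The same for the conjugates: `2A σθ₁ = (−B ± s) σθ₀`. [folklore] -/
theorem two_A_mul_conj_theta₁_eq :
    2 * (a.hess.1 : K) * σ θ₁ = (-(a.hess.2.1 : K) + s) * σ θ₀ ∨
      2 * (a.hess.1 : K) * σ θ₁ = (-(a.hess.2.1 : K) - s) * σ θ₀ := by
  rcases two_A_mul_theta₁_eq a σ hs hD h02 h13 h03 hπ₀ hπ₁ hπ₂ hπ₃ with h | h
  · right
    have := congrArg σ h
    simp [hσ, map_ofNat] at this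
    linear_combination this
  · left
    have := congrArg σ h
    simp [hσ, map_ofNat] at this
    linear_combination this

omit hσ hD h02 h13 h03 hπ₀ hπ₁ hπ₂ hπ₃ in
/-- The key identity between Bhargava's values: `(−B + s) θ₀(a) = 2A θ₁(a)` (i.e. `θ(a)` lies in the
`+` branch of `two_A_mul_theta₁_eq`), from `g₀ = 2Aa₁ + Ba₀` and `2Ag₁ + Bg₀ = a₀ D`. [folklore] -/
theorem thetaForm_branch :
    (-(a.hess.2.1 : K) + s) * (a.thetaForm s).a₀ = 2 * (a.hess.1 : K) * (a.thetaForm s).a₁ := by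
  have eg₀ : (a.gCov.a₀ : K) = 2 * (a.hess.1 : K) * a.a₁ + (a.hess.2.1 : K) * a.a₀ := by
    simp only [gCov, hess]; push_cast; ring
  have eg₁ : 2 * (a.hess.1 : K) * (a.gCov.a₁ : K) + (a.hess.2.1 : K) * (a.gCov.a₀ : K)
      = (a.a₀ : K) * s ^ 2 := by
    rw [hs]; simp only [gCov, hess, disc]; push_cast; ring
  simp only [thetaForm_a₀, thetaForm_a₁]
  linear_combination (-(1 : K) / 2) * eg₁ + (s / 2) * eg₀

/-- **Uniqueness** (HCL I, proof of Thm 13: "exactly one solution" for the `cᵢ` once the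
orientation is fixed). A nondegenerate geometric progression `θ₀, …, θ₃` in `K` whose `π`-parts
are `(a₀, …, a₃)` (`θᵢ − σθᵢ = aᵢ s`, `s² = disc a` non-square, `σ s = −s`) is either Bhargava's
`θ(a) = ((gᵢ + aᵢ s)/2)ᵢ` or its conjugate-opposite `(−σθᵢ(a))ᵢ = ((−gᵢ + aᵢ s)/2)ᵢ`.
[cite: Bhargava2004HCL1, §3.4 (proof of Theorem 13: the system for the cᵢ has exactly one solution given the orientation)] -/
theorem eq_thetaForm_or_eq_neg_conj (hnd : θ₀ * σ θ₁ ≠ σ θ₀ * θ₁) :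
    (θ₀ = (a.thetaForm s).a₀ ∧ θ₁ = (a.thetaForm s).a₁ ∧ θ₂ = (a.thetaForm s).a₂ ∧ θ₃ = (a.thetaForm s).a₃) ∨
    (θ₀ = -σ (a.thetaForm s).a₀ ∧ θ₁ = -σ (a.thetaForm s).a₁ ∧ θ₂ = -σ (a.thetaForm s).a₂ ∧
      θ₃ = -σ (a.thetaForm s).a₃) := by
  have hs0 := s_ne_zero_of_not_isSquare a hs hD
  have hA0 : (a.hess.1 : K) ≠ 0 := by exact_mod_cast hess_A_ne_zero_of_not_isSquare a hD
  have h2A : (2 * (a.hess.1 : K)) ≠ 0 := mul_ne_zero two_ne_zero hA0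
  set T := a.thetaForm s with hT
  -- Bhargava's values: first coordinates, relations, branch identity, conjugates
  have hT₀ : 2 * T.a₀ = (a.gCov.a₀ : K) + (a.a₀ : K) * s := by
    simp only [hT, thetaForm_a₀]; ring
  have eg₀ : (a.gCov.a₀ : K) = 2 * (a.hess.1 : K) * a.a₁ + (a.hess.2.1 : K) * a.a₀ := by
    simp only [gCov, hess]; push_cast; ring
  have hT02 : T.a₀ * T.a₂ = T.a₁ ^ 2 := thetaForm_a₀_mul_a₂ a hs
  have hT03 : T.a₀ * T.a₃ = T.a₁ * T.a₂ := thetaForm_a₀_mul_a₃ a hs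
  have hbr : (-(a.hess.2.1 : K) + s) * T.a₀ = 2 * (a.hess.1 : K) * T.a₁ := thetaForm_branch a hs
  have hσT₀ : σ T.a₀ = ((a.gCov.a₀ : K) - (a.a₀ : K) * s) / 2 := by
    simp only [hT, thetaForm_a₀, map_div₀, map_add, map_mul, map_intCast, map_ofNat, hσ]; ring
  have hT₀ne : T.a₀ ≠ 0 := thetaForm_a₀_ne_zero a hs hD
  -- `θ₀ ≠ 0`
  have hθ₀ : θ₀ ≠ 0 := by
    intro h
    apply hnd
    rw [h, map_zero, zero_mul, zero_mul]
  rcases two_A_mul_theta₁_eq a σ hs hD h02 h13 h03 hπ₀ hπ₁ hπ₂ hπ₃ with h1 | h1 <;>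
    rcases two_A_mul_conj_theta₁_eq a σ hσ hs hD h02 h13 h03 hπ₀ hπ₁ hπ₂ hπ₃ with h2 | h2
  · -- equal signs `(+,+)`: degenerate
    exfalso; apply hnd
    have : 2 * (a.hess.1 : K) * (θ₀ * σ θ₁ - σ θ₀ * θ₁) = 0 := by
      linear_combination θ₀ * h2 - σ θ₀ * h1
    rcases mul_eq_zero.mp this with h | h
    · exact absurd h h2A
    · exact sub_eq_zero.mp h
  · -- `(+,−)`: the positively oriented case, `θ = θ(a)`
    left
    have hsum : θ₀ + σ θ₀ = (a.gCov.a₀ : K) := by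
      have h3 : s * (θ₀ + σ θ₀ - (a.gCov.a₀ : K)) = 0 := by
        rw [eg₀]
        linear_combination h2 - h1 + (2 * (a.hess.1 : K)) * hπ₁ + (a.hess.2.1 : K) * hπ₀
      rcases mul_eq_zero.mp h3 with h | h
      · exact absurd h hs0
      · exact sub_eq_zero.mp h
    have e0 : θ₀ = T.a₀ := by
      have : 2 * θ₀ = 2 * T.a₀ := by rw [hT₀]; linear_combination hsum + hπ₀
      exact mul_left_cancel₀ two_ne_zero this
    have e1 : θ₁ = T.a₁ := by
      refine mul_left_cancel₀ h2A ?_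
      rw [h1, e0, hbr]
    obtain ⟨e2, e3⟩ := progression_eq_of_eq h02 h03 hT02 hT03 e0 e1 hT₀ne
    exact ⟨e0, e1, e2, e3⟩
  · -- `(−,+)`: the negatively oriented case, `θ = −σθ(a)`
    right
    have hsum : θ₀ + σ θ₀ = -(a.gCov.a₀ : K) := by
      have h3 : s * (θ₀ + σ θ₀ + (a.gCov.a₀ : K)) = 0 := by
        rw [eg₀]
        linear_combination h1 - h2 - (2 * (a.hess.1 : K)) * hπ₁ - (a.hess.2.1 : K) * hπ₀
      rcases mul_eq_zero.mp h3 with h | h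
      · exact absurd h hs0
      · exact eq_neg_of_add_eq_zero_left h
    have e0 : θ₀ = -σ T.a₀ := by
      rw [hσT₀]
      have : 2 * θ₀ = 2 * (-(((a.gCov.a₀ : K) - (a.a₀ : K) * s) / 2)) := by
        linear_combination hsum + hπ₀
      exact mul_left_cancel₀ two_ne_zero this
    -- the conjugate branch identity `(−B − s) σT₀ = 2A σT₁`
    have hbr' : (-(a.hess.2.1 : K) - s) * (-σ T.a₀) = 2 * (a.hess.1 : K) * (-σ T.a₁) := by
      have := congrArg σ hbr
      simp [hσ, map_ofNat] at this
      linear_combination -this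
    have e1 : θ₁ = -σ T.a₁ := by
      refine mul_left_cancel₀ h2A ?_
      rw [h1, e0, hbr']
    have hS02 : (-σ T.a₀) * (-σ T.a₂) = (-σ T.a₁) ^ 2 := by
      have := congrArg σ hT02
      simp only [map_mul, map_pow] at this
      linear_combination this
    have hS03 : (-σ T.a₀) * (-σ T.a₃) = (-σ T.a₁) * (-σ T.a₂) := by
      have := congrArg σ hT03
      simp only [map_mul] at this
      linear_combination this
    have hS₀ne : -σ T.a₀ ≠ 0 := by rw [← e0]; exact hθ₀
    obtain ⟨e2, e3⟩ := progression_eq_of_eq h02 h03 hS02 hS03 e0 e1 hS₀ne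
    exact ⟨e0, e1, e2, e3⟩
  · -- equal signs `(−,−)`: degenerate
    exfalso; apply hnd
    have : 2 * (a.hess.1 : K) * (θ₀ * σ θ₁ - σ θ₀ * θ₁) = 0 := by
      linear_combination θ₀ * h2 - σ θ₀ * h1
    rcases mul_eq_zero.mp this with h | h
    · exact absurd h h2A
    · exact sub_eq_zero.mp h

end Uniqueness

end SymCubic

end Literature.NumberTheory.CubicFields
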